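import Mathlib
import Literature.Analysis.FluidPDE.VectorCalculus
import Literature.Analysis.FluidPDE.VortexFilament.CurlEnergy
import Summits.NavierStokesRegularity.NavierStokesRegularity.Theorems.FilamentSkeletonRssSkeletonEquilibriumLineBiotSavart

/-!
# Route `FilamentSkeletonRss` · crux `SelectionBoxRJ` (stmt-NavierStokesRegularity-21220) — rung 0 (straight-skew limit of the
2-filament datum of record): TOOLS

Lane `ns-filament-19175-p1` (g5).  Elementary lemmas consumed by `FilamentSkeletonRssSelectionBoxRJRungStraightSkew.lean`:
explicit 3-vector algebra (`WithLp.toLp 2 ![a,b,c]`: inner and cross products, norms), the vanishing of the regularised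
Biot–Savart self-induction on a straight line, and the calculus of the scale-free tangential-speed profile
`s ↦ a/(b + s²) + s/2 − k` (`a = 4/(5π)`, `k = (21/25)/√2`, `b = 4/25 + 1/Γ ∈ [4/25, 4/25 + 10⁻⁴]`): sign at `s = −41/100`
and `−39/100`, positivity on `[0, ∞)`, strict monotonicity on `(−∞, 0]`, the slope window `[23/10, 27/10]` on
`[−41/100, −39/100]`, and the derivative of the rescaled profile.  Route-independent; negative-side/constructive
bookkeeping only — nothing here is a claim about Navier–Stokes regularity or blow-up.
-/

set_option linter.dupNamespace false

noncomputable section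

namespace Summit.NavierStokesRegularity.NavierStokesRegularity.Theorems

open Set Function Filter MeasureTheory Real
open Literature.Analysis.FluidPDE
open scoped InnerProductSpace Topology

namespace SelectionBoxRJRung

/-! ### Explicit 3-vectors `WithLp.toLp 2 ![a, b, c]` -/

/-- Inner product of explicit vectors. [folklore] -/
theorem inner_vec3 (a b c a' b' c' : ℝ) :
    ⟪(WithLp.toLp 2 ![a, b, c] : EuclideanSpace ℝ (Fin 3)), WithLp.toLp 2 ![a', b', c']⟫_ℝ = a * a' + b * b' + c * c' := by
  simp [PiLp.inner_apply, Fin.sum_univ_three]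
  ring

/-- Cross product of explicit vectors. [folklore] -/
theorem cross_vec3 (a b c a' b' c' : ℝ) :
    cross (WithLp.toLp 2 ![a, b, c]) (WithLp.toLp 2 ![a', b', c']) =
      WithLp.toLp 2 ![b * c' - c * b', c * a' - a * c', a * b' - b * a'] := by
  ext i
  fin_cases i <;> simp [cross, crossProduct]

/-- Sum of explicit vectors. [folklore] -/
theorem add_vec3 (a b c a' b' c' : ℝ) :
    (WithLp.toLp 2 ![a, b, c] : EuclideanSpace ℝ (Fin 3)) + WithLp.toLp 2 ![a', b', c'] =
      WithLp.toLp 2 ![a + a', b + b', c + c'] := by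
  ext i; fin_cases i <;> simp

/-- Difference of explicit vectors. [folklore] -/
theorem sub_vec3 (a b c a' b' c' : ℝ) :
    (WithLp.toLp 2 ![a, b, c] : EuclideanSpace ℝ (Fin 3)) - WithLp.toLp 2 ![a', b', c'] =
      WithLp.toLp 2 ![a - a', b - b', c - c'] := by
  ext i; fin_cases i <;> simp

/-- Scalar multiple of an explicit vector. [folklore] -/
theorem smul_vec3 (r a b c : ℝ) :
    r • (WithLp.toLp 2 ![a, b, c] : EuclideanSpace ℝ (Fin 3)) = WithLp.toLp 2 ![r * a, r * b, r * c] := by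
  ext i; fin_cases i <;> simp

/-- `e₃ = (0, 0, 1)`. [folklore] -/
theorem single_two_eq_vec3 :
    (EuclideanSpace.single (2 : Fin 3) (1 : ℝ) : EuclideanSpace ℝ (Fin 3)) = WithLp.toLp 2 ![0, 0, 1] := by
  ext i; fin_cases i <;> simp

/-- `1/√2 · 1/√2 = 1/2`. [folklore] -/
theorem inv_sqrt_two_mul_self : (Real.sqrt 2)⁻¹ * (Real.sqrt 2)⁻¹ = 1 / 2 := by
  rw [← mul_inv, Real.mul_self_sqrt (by norm_num : (0:ℝ) ≤ 2)]; norm_num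

/-- The tilted unit tangent `(0, 1/√2, 1/√2)` has norm 1. [folklore] -/
theorem norm_tangent₁ : ‖(WithLp.toLp 2 ![0, (Real.sqrt 2)⁻¹, (Real.sqrt 2)⁻¹] : EuclideanSpace ℝ (Fin 3))‖ = 1 := by
  have h : ‖(WithLp.toLp 2 ![0, (Real.sqrt 2)⁻¹, (Real.sqrt 2)⁻¹] : EuclideanSpace ℝ (Fin 3))‖ ^ 2 = 1 := by
    rw [VortexFilament.norm_sq_toLp_three]; have := inv_sqrt_two_mul_self; nlinarith [this]
  nlinarith [h, norm_nonneg (WithLp.toLp 2 ![0, (Real.sqrt 2)⁻¹, (Real.sqrt 2)⁻¹] : EuclideanSpace ℝ (Fin 3))]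

/-- The image tangent `(0, −1/√2, 1/√2)` has norm 1. [folklore] -/
theorem norm_tangent₂ : ‖(WithLp.toLp 2 ![0, -(Real.sqrt 2)⁻¹, (Real.sqrt 2)⁻¹] : EuclideanSpace ℝ (Fin 3))‖ = 1 := by
  have h : ‖(WithLp.toLp 2 ![0, -(Real.sqrt 2)⁻¹, (Real.sqrt 2)⁻¹] : EuclideanSpace ℝ (Fin 3))‖ ^ 2 = 1 := by
    rw [VortexFilament.norm_sq_toLp_three]; have := inv_sqrt_two_mul_self; nlinarith [this]
  nlinarith [h, norm_nonneg (WithLp.toLp 2 ![0, -(Real.sqrt 2)⁻¹, (Real.sqrt 2)⁻¹] : EuclideanSpace ℝ (Fin 3))]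

/-! ### Straight lines: derivative and vanishing self-induction -/

/-- A straight unit-speed line `τ ↦ P + τ e` has derivative `e`. [folklore] -/
theorem hasDerivAt_line (P e : EuclideanSpace ℝ (Fin 3)) (τ : ℝ) :
    HasDerivAt (fun t : ℝ => P + t • e) e τ := by
  have h : HasDerivAt (fun x : ℝ => P + x • e) ((1 : ℝ) • e) τ :=
    HasDerivAt.const_add P ((hasDerivAt_id τ).smul_const e)
  rw [one_smul] at h
  exact h

/-- `deriv (τ ↦ P + τ e) = e`. [folklore] -/
theorem deriv_line (P e : EuclideanSpace ℝ (Fin 3)) : deriv (fun t : ℝ => P + t • e) = fun _ => e := by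
  funext τ; exact (hasDerivAt_line P e τ).deriv

/-- The regularised Biot–Savart self-induction of a straight line vanishes at its own points (the integrand is
identically zero). [folklore] -/
theorem self_integral_zero (P e : EuclideanSpace ℝ (Fin 3)) (τ : ℝ) :
    ∫ σ : ℝ, ((‖(P + τ • e) - (P + σ • e)‖ ^ 2 + 1) ^ (3 / 2 : ℝ))⁻¹ • cross e ((P + τ • e) - (P + σ • e)) = 0 := by
  have hz : ∀ σ : ℝ, cross e ((P + τ • e) - (P + σ • e)) = 0 := by
    intro σ
    have : (P + τ • e) - (P + σ • e) = (τ - σ) • e := by rw [sub_smul]; abel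
    rw [this]
    ext i
    fin_cases i <;> simp [cross, crossProduct, mul_comm]
  have hf : (fun σ : ℝ => ((‖(P + τ • e) - (P + σ • e)‖ ^ 2 + 1) ^ (3 / 2 : ℝ))⁻¹ • cross e ((P + τ • e) - (P + σ • e))) =
      fun _ => (0 : EuclideanSpace ℝ (Fin 3)) := by
    funext σ; rw [hz σ, smul_zero]
  rw [hf, integral_zero]

/-! ### The scale-free profile `s ↦ a/(b + s²) + s/2 − k`, `a = 4/(5π)`, `k = (21/25)/√2`, `b = 4/25 + 1/Γ` -/

/-- `0.25464 < 4/(5π) < 0.25465`. [folklore] -/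
theorem aC_bounds : 0.25464 < 4 / (5 * Real.pi) ∧ 4 / (5 * Real.pi) < 0.25465 := by
  have h1 := Real.pi_gt_d6
  have h2 := Real.pi_lt_d6
  constructor
  · rw [lt_div_iff₀ (by positivity)]; nlinarith
  · rw [div_lt_iff₀ (by positivity)]; nlinarith

/-- `1.41421 < √2 < 1.41422`. [folklore] -/
theorem sqrt_two_bounds : 1.41421 < Real.sqrt 2 ∧ Real.sqrt 2 < 1.41422 := by
  constructor
  · rw [show (1.41421:ℝ) = Real.sqrt (1.41421^2) by rw [Real.sqrt_sq (by norm_num)]]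
    exact Real.sqrt_lt_sqrt (by norm_num) (by norm_num)
  · rw [show (1.41422:ℝ) = Real.sqrt (1.41422^2) by rw [Real.sqrt_sq (by norm_num)]]
    exact Real.sqrt_lt_sqrt (by norm_num) (by norm_num)

/-- `0.59396 < (21/25)/√2 < 0.59398`. [folklore] -/
theorem kC_bounds : 0.59396 < 21 / 25 * (Real.sqrt 2)⁻¹ ∧ 21 / 25 * (Real.sqrt 2)⁻¹ < 0.59398 := by
  obtain ⟨h1, h2⟩ := sqrt_two_bounds
  have hpos : 0 < Real.sqrt 2 := by positivity
  rw [← div_eq_mul_inv]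
  constructor
  · rw [lt_div_iff₀ hpos]; nlinarith
  · rw [div_lt_iff₀ hpos]; nlinarith

/-- The profile is negative at `s = −41/100` (for `b ≥ 4/25`). [folklore] -/
theorem F_neg {b : ℝ} (hb : 4 / 25 ≤ b) :
    4 / (5 * Real.pi) / (b + (-41 / 100 : ℝ) ^ 2) + (-41 / 100 : ℝ) / 2 - 21 / 25 * (Real.sqrt 2)⁻¹ < 0 := by
  obtain ⟨ha1, ha2⟩ := aC_bounds
  obtain ⟨hk1, hk2⟩ := kC_bounds
  have hden : 0 < b + (-41 / 100 : ℝ) ^ 2 := by nlinarith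
  have : 4 / (5 * Real.pi) / (b + (-41 / 100 : ℝ) ^ 2) < 41 / 200 + 21 / 25 * (Real.sqrt 2)⁻¹ := by
    rw [div_lt_iff₀ hden]; nlinarith
  linarith

/-- The profile is positive at `s = −39/100` (for `4/25 ≤ b ≤ 4/25 + 10⁻⁴`). [folklore] -/
theorem F_pos {b : ℝ} (hb : 4 / 25 ≤ b) (hb' : b ≤ 4 / 25 + 1 / 10000) :
    0 < 4 / (5 * Real.pi) / (b + (-39 / 100 : ℝ) ^ 2) + (-39 / 100 : ℝ) / 2 - 21 / 25 * (Real.sqrt 2)⁻¹ := by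
  obtain ⟨ha1, ha2⟩ := aC_bounds
  obtain ⟨hk1, hk2⟩ := kC_bounds
  have hden : 0 < b + (-39 / 100 : ℝ) ^ 2 := by nlinarith
  have : 39 / 200 + 21 / 25 * (Real.sqrt 2)⁻¹ < 4 / (5 * Real.pi) / (b + (-39 / 100 : ℝ) ^ 2) := by
    rw [lt_div_iff₀ hden]; nlinarith
  linarith

/-- The profile is positive on `[0, ∞)` (no second zero): polynomial certificate for
`a + (s/2 − k)(b + s²) > 0`. [folklore] -/
theorem F_pos_of_nonneg {b : ℝ} (hb : 4 / 25 ≤ b) (hb' : b ≤ 4 / 25 + 1 / 10000) {s : ℝ} (hs : 0 ≤ s) :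
    0 < 4 / (5 * Real.pi) / (b + s ^ 2) + s / 2 - 21 / 25 * (Real.sqrt 2)⁻¹ := by
  obtain ⟨ha1, ha2⟩ := aC_bounds
  obtain ⟨hk1, hk2⟩ := kC_bounds
  set a : ℝ := 4 / (5 * Real.pi) with ha
  set k : ℝ := 21 / 25 * (Real.sqrt 2)⁻¹ with hk
  have hden : 0 < b + s ^ 2 := by nlinarith
  have key : 0 < a + (s / 2 - k) * (b + s ^ 2) := by
    nlinarith [mul_nonneg (sq_nonneg (s - 18 / 25)) (by linarith : (0:ℝ) ≤ s + 1 / 4), mul_nonneg hs (sq_nonneg s),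
      sq_nonneg (s - 18/25), mul_nonneg hs (by linarith : (0:ℝ) ≤ 4 / 25 + 1 / 10000 - b)]
  have : a / (b + s ^ 2) + s / 2 - k = (a + (s / 2 - k) * (b + s ^ 2)) / (b + s ^ 2) := by
    field_simp
    ring
  rw [this]
  positivity

/-- The profile is strictly increasing on `(−∞, 0]` (for `b ≥ 4/25`). [folklore] -/
theorem F_strictMonoOn {b : ℝ} (hb : 4 / 25 ≤ b) :
    StrictMonoOn (fun s : ℝ => 4 / (5 * Real.pi) / (b + s ^ 2) + s / 2 - 21 / 25 * (Real.sqrt 2)⁻¹) (Iic 0) := by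
  obtain ⟨ha1, _⟩ := aC_bounds
  intro s hs t ht hst
  simp only [mem_Iic] at hs ht
  have h1 : 0 < b + t ^ 2 := by nlinarith
  have h3 : t ^ 2 ≤ s ^ 2 := by nlinarith
  have h4 : 1 / (b + s ^ 2) ≤ 1 / (b + t ^ 2) := one_div_le_one_div_of_le h1 (by linarith)
  have h5 : 4 / (5 * Real.pi) / (b + s ^ 2) ≤ 4 / (5 * Real.pi) / (b + t ^ 2) := by
    rw [div_eq_mul_one_div (4 / (5 * Real.pi)), div_eq_mul_one_div (4 / (5 * Real.pi)) (b + t ^ 2)]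
    exact mul_le_mul_of_nonneg_left h4 (by linarith)
  show 4 / (5 * Real.pi) / (b + s ^ 2) + s / 2 - 21 / 25 * (Real.sqrt 2)⁻¹ <
    4 / (5 * Real.pi) / (b + t ^ 2) + t / 2 - 21 / 25 * (Real.sqrt 2)⁻¹
  linarith

/-- Slope window on `[−41/100, −39/100]`: `23/10 ≤ ½ − 2 a s/(b + s²)² ≤ 27/10`. [folklore] -/
theorem Fderiv_window {b s : ℝ} (hb : 4 / 25 ≤ b) (hb' : b ≤ 4 / 25 + 1 / 10000) (hs1 : -41 / 100 ≤ s)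
    (hs2 : s ≤ -39 / 100) :
    23 / 10 ≤ 1 / 2 - 2 * (4 / (5 * Real.pi)) * s / (b + s ^ 2) ^ 2 ∧
      1 / 2 - 2 * (4 / (5 * Real.pi)) * s / (b + s ^ 2) ^ 2 ≤ 27 / 10 := by
  obtain ⟨ha1, ha2⟩ := aC_bounds
  set a : ℝ := 4 / (5 * Real.pi) with ha
  have hs2' : 0.1521 ≤ s ^ 2 := by nlinarith
  have hs2'' : s ^ 2 ≤ 0.1681 := by nlinarith
  have hD1 : 0.0974 ≤ (b + s ^ 2) ^ 2 := by nlinarith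
  have hD2 : (b + s ^ 2) ^ 2 ≤ 0.1078 := by nlinarith
  have hDpos : 0 < (b + s ^ 2) ^ 2 := by linarith
  have hN1 : 0.1986 ≤ -(2 * a * s) := by nlinarith
  have hN2 : -(2 * a * s) ≤ 0.2089 := by nlinarith
  have hrw : 2 * a * s / (b + s ^ 2) ^ 2 = -(-(2 * a * s) / (b + s ^ 2) ^ 2) := by ring
  constructor
  · have : 1.8 ≤ -(2 * a * s) / (b + s ^ 2) ^ 2 := by
      rw [le_div_iff₀ hDpos]; nlinarith
    linarith
  · have : -(2 * a * s) / (b + s ^ 2) ^ 2 ≤ 2.2 := by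
      rw [div_le_iff₀ hDpos]; nlinarith
    linarith

/-- `Γ ≥ 10⁴ ⇒ b = 4/25 + 1/Γ ∈ [4/25, 4/25 + 10⁻⁴]`. [folklore] -/
theorem b_bounds {Γ : ℝ} (hΓ : 10 ^ 4 ≤ Γ) : 4 / 25 ≤ 4 / 25 + 1 / Γ ∧ 4 / 25 + 1 / Γ ≤ 4 / 25 + 1 / 10000 := by
  have hΓ0 : 0 < Γ := by linarith [show (0:ℝ) < 10 ^ 4 by norm_num]
  constructor
  · have : 0 ≤ 1 / Γ := by positivity
    linarith
  · have : 1 / Γ ≤ 1 / 10000 := one_div_le_one_div_of_le (by norm_num) (by linarith)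
    linarith

/-- Derivative of the rescaled profile `t ↦ √Γ·F(t/√Γ)`: `½ − 2a s/(b+s²)²` at `s = t/√Γ`. [folklore] -/
theorem hasDerivAt_profile {Γ : ℝ} (hΓ : 0 < Γ) (b : ℝ) (hbpos : 0 < b) (τ : ℝ) :
    HasDerivAt (fun t : ℝ => Real.sqrt Γ *
        (4 / (5 * Real.pi) / (b + (t / Real.sqrt Γ) ^ 2) + (t / Real.sqrt Γ) / 2 - 21 / 25 * (Real.sqrt 2)⁻¹))
      (1 / 2 - 2 * (4 / (5 * Real.pi)) * (τ / Real.sqrt Γ) / (b + (τ / Real.sqrt Γ) ^ 2) ^ 2) τ := by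
  have hG : 0 < Real.sqrt Γ := Real.sqrt_pos.mpr hΓ
  set a : ℝ := 4 / (5 * Real.pi) with ha
  set k : ℝ := 21 / 25 * (Real.sqrt 2)⁻¹ with hk
  have hFd : ∀ s₀ : ℝ, HasDerivAt (fun s : ℝ => a / (b + s ^ 2) + s / 2 - k)
      (a * (-(2 * s₀) / (b + s₀ ^ 2) ^ 2) + 1 / 2) s₀ := by
    intro s₀
    have hden : HasDerivAt (fun s : ℝ => b + s ^ 2) (2 * s₀) s₀ := by
      have := (hasDerivAt_pow 2 s₀).const_add b
      simpa using this
    have hne : b + s₀ ^ 2 ≠ 0 := by positivity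
    have h1 : HasDerivAt (fun s : ℝ => a * (b + s ^ 2)⁻¹) (a * (-(2 * s₀) / (b + s₀ ^ 2) ^ 2)) s₀ :=
      (hden.inv hne).const_mul a
    have h2 : HasDerivAt (fun s : ℝ => s * (1 / 2)) (1 * (1 / 2)) s₀ := (hasDerivAt_id s₀).mul_const (1 / 2)
    have h3 : HasDerivAt (fun s : ℝ => a * (b + s ^ 2)⁻¹ + s * (1 / 2) - k)
        (a * (-(2 * s₀) / (b + s₀ ^ 2) ^ 2) + 1 * (1 / 2)) s₀ := (h1.add h2).sub_const k
    have hF : (fun s : ℝ => a / (b + s ^ 2) + s / 2 - k) = fun s : ℝ => a * (b + s ^ 2)⁻¹ + s * (1 / 2) - k := by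
      funext s; ring
    rw [hF]
    convert h3 using 1
    ring
  have hinner : HasDerivAt (fun t : ℝ => t / Real.sqrt Γ) (1 / Real.sqrt Γ) τ := by
    simpa using (hasDerivAt_id τ).div_const (Real.sqrt Γ)
  have hcomp := HasDerivAt.comp τ (hFd (τ / Real.sqrt Γ)) hinner
  have hfin : HasDerivAt (fun t : ℝ => Real.sqrt Γ * (a / (b + (t / Real.sqrt Γ) ^ 2) + (t / Real.sqrt Γ) / 2 - k))
      (Real.sqrt Γ * ((a * (-(2 * (τ / Real.sqrt Γ)) / (b + (τ / Real.sqrt Γ) ^ 2) ^ 2) + 1 / 2) * (1 / Real.sqrt Γ))) τ :=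
    hcomp.const_mul (Real.sqrt Γ)
  refine hfin.congr_deriv ?_
  field_simp
  ring

/-! ### Explicit geometry of the straight pair -/

/-- The point of filament 1 at parameter `τ`. [folklore] -/
theorem pt₁ (Γ τ : ℝ) :
    (WithLp.toLp 2 ![Real.sqrt Γ / 5, 0, 0] : EuclideanSpace ℝ (Fin 3)) + τ • WithLp.toLp 2 ![0, (Real.sqrt 2)⁻¹, (Real.sqrt 2)⁻¹]
      = WithLp.toLp 2 ![Real.sqrt Γ / 5, τ * (Real.sqrt 2)⁻¹, τ * (Real.sqrt 2)⁻¹] := by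
  rw [smul_vec3, add_vec3]; congr 1; simp

/-- The point of filament 1 at parameter `τ`, seen from the waist point of filament 2. [folklore] -/
theorem pt₁_sub_P₂ (Γ τ : ℝ) :
    (WithLp.toLp 2 ![Real.sqrt Γ / 5, 0, 0] : EuclideanSpace ℝ (Fin 3)) + τ • WithLp.toLp 2 ![0, (Real.sqrt 2)⁻¹, (Real.sqrt 2)⁻¹]
      - WithLp.toLp 2 ![-(Real.sqrt Γ / 5), 0, 0]
      = WithLp.toLp 2 ![2 * Real.sqrt Γ / 5, τ * (Real.sqrt 2)⁻¹, τ * (Real.sqrt 2)⁻¹] := by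
  rw [pt₁, sub_vec3]
  congr 1
  funext i
  fin_cases i
  · simp; ring
  · simp
  · simp

end SelectionBoxRJRung

end Summit.NavierStokesRegularity.NavierStokesRegularity.Theorems
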